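import Mathlib
import Summits.NavierStokesRegularity.NavierStokesRegularity.Theorems.EulerZoomLiouvillePowerGaugeEulerLiouvilleKillingRotation
import Summits.NavierStokesRegularity.NavierStokesRegularity.Theorems.EulerZoomLiouvillePowerGaugeEulerLiouvilleKillingShear
import Summits.NavierStokesRegularity.NavierStokesRegularity.Theorems.EulerZoomLiouvillePowerGaugeEulerLiouvilleGalileanHarmonicShear
import Summits.NavierStokesRegularity.NavierStokesRegularity.Theorems.CoriolisHeadTypeIRateTransport
import Literature.Analysis.FluidPDE.TypeIAncientMildRssPullback
import Literature.Analysis.FluidPDE.WeakGradientIBP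
import HarnessLib

/-!
# Crux E `PowerGaugeEulerLiouville` (stmt-NavierStokesRegularity-19832): SCREW MOTIONS `S_t z = exp(tB) z + t b` (`B` skew, `Bb = 0`) —
# pairing tools for the general Killing-field shear lemma (width seat ns-ezl-w3 g5)

Route №10 `EulerZoomLiouville` (NavierStokesRegularity), crux E.  Every Killing field of `ℝ³` is, after recentring, a SCREW field `κ(y) = By + b` with
`B` skew and `Bb = 0`; its flow is the one-parameter group of rigid motions `S_t z = R_t z + t b`, `R_t = exp(tB)`, with inverse `X_t w = R_{−t}(w − t b)`.
This file carries the translation-invariant (`GalileanFrames.harmonicShearVanishes`, g4) and rotational (`Killing.killingShearVanishes`, this seat)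
pairing arguments over to screw motions:

* `Killing.expSkew_apply_of_ker` — `R_t b = b` for `b ∈ ker B`; `Killing.hasDerivAt_screwInv_apply` — `d/dt X_t w = −(B X_t w + b)`;
* `Killing.integral_comp_screw` — `∫ G(S_t z) dz = ∫ G`; `Killing.hasCompactSupport_comp_screwInv`, `Killing.hasFDerivAt_screwRotate`;
* `Killing.integral_inner_screw_eq_of_shear` — if for every `t` the transported test field `Ξ_t = R_t Ξ(X_t ·)` satisfies
  `∫⟪U, DΞ_t(κ) − BΞ_t⟫ = 0`, then `t ↦ ∫⟪U, Ξ_t⟫` is constant (dominated differentiation under the integral).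

WHAT THIS IS NOT: not NS regularity, not the crux E — tools for the `E(3)` symmetry strata of the crux CLASS 19832 (MODEL lattice; E/NS strata),
`--supports` stmt-19832; 19832 OPEN. [folklore]
-/

noncomputable section

-- flat `Theorems/<Route><Decl>…` files of one crux share the namespace of the crux (tree convention: `Summit.<S>.<S>.…`)
set_option linter.dupNamespace false

open MeasureTheory Set Filter Topology Metric Function TopologicalSpace InnerProductSpace
open scoped ENNReal NNReal RealInnerProductSpace

namespace Summit.NavierStokesRegularity.NavierStokesRegularity.Theorems.PowerGaugeEulerLiouville

namespace Killing

open Literature.Analysis Literature.Analysis.FunctionSpaces Literature.Analysis.FluidPDE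
open Summit.NavierStokesRegularity.NavierStokesRegularity.Theorems.CoriolisHead
open Summit.NavierStokesRegularity.NavierStokesRegularity.Theorems.PowerGaugeEulerLiouville.GalileanFrames

variable {B : EuclideanSpace ℝ (Fin 3) →L[ℝ] EuclideanSpace ℝ (Fin 3)} {b : EuclideanSpace ℝ (Fin 3)}

/-- `R_t b = b` for `b ∈ ker B` (the derivative `B R_t b = R_t B b` vanishes). [folklore] -/
theorem expSkew_apply_of_ker (hb : B b = 0) (t : ℝ) : NormedSpace.exp (t • B) b = b := by
  have hd : ∀ s, HasDerivAt (fun s : ℝ => NormedSpace.exp (s • B) b) 0 s := by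
    intro s
    have h := TypeIRate.hasDerivAt_flow B b s
    rwa [← TypeIRate.exp_smul_apply_comm, hb, map_zero] at h
  have hdiff : Differentiable ℝ fun s : ℝ => NormedSpace.exp (s • B) b := fun s => (hd s).differentiableAt
  have h := is_const_of_deriv_eq_zero hdiff (fun s => (hd s).deriv) t 0
  rwa [expSkew_zero_apply] at h

/-- `d/dt X_t w = −(B X_t w + b)` for the inverse screw motion `X_t w = R_{−t}(w − t b)` (`Bb = 0`). [folklore] -/
theorem hasDerivAt_screwInv_apply (B : EuclideanSpace ℝ (Fin 3) →L[ℝ] EuclideanSpace ℝ (Fin 3)) (hb : B b = 0)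
    (w : EuclideanSpace ℝ (Fin 3)) (t : ℝ) :
    HasDerivAt (fun s : ℝ => NormedSpace.exp ((-s) • B) (w - s • b))
      (-(B (NormedSpace.exp ((-t) • B) (w - t • b)) + b)) t := by
  have e1 : (fun s : ℝ => NormedSpace.exp ((-s) • B) (w - s • b)) = fun s => NormedSpace.exp ((-s) • B) w - s • b := by
    funext s; rw [map_sub, map_smul, expSkew_apply_of_ker hb]
  rw [e1]
  have h := (hasDerivAt_expSkew_neg_apply B w t).sub ((hasDerivAt_id t).smul_const b)
  refine h.congr_deriv ?_
  have e2 : B (NormedSpace.exp ((-t) • B) (w - t • b)) = B (NormedSpace.exp ((-t) • B) w) := by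
    rw [map_sub, map_smul, expSkew_apply_of_ker hb, map_sub, map_smul, hb, smul_zero, sub_zero]
  rw [e2, one_smul]
  abel

/-- Integrals are invariant under screw motions of the argument: `∫ G(R_t z + t b) dz = ∫ G`. [folklore] -/
theorem integral_comp_screw (hB : ∀ x : EuclideanSpace ℝ (Fin 3), ⟪B x, x⟫ = 0) (t : ℝ) (b : EuclideanSpace ℝ (Fin 3))
    {F : Type*} [NormedAddCommGroup F] [NormedSpace ℝ F] (G : EuclideanSpace ℝ (Fin 3) → F) :
    ∫ z, G (NormedSpace.exp (t • B) z + t • b) = ∫ y, G y := by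
  have h := integral_comp_expSkew hB t (fun w => G (w + t • b))
  beta_reduce at h
  rw [h]
  exact integral_add_right_eq_self _ _

/-- Precomposition with an inverse screw motion preserves compact support. [folklore] -/
theorem hasCompactSupport_comp_screwInv (hB : ∀ x : EuclideanSpace ℝ (Fin 3), ⟪B x, x⟫ = 0) (s : ℝ) (c : EuclideanSpace ℝ (Fin 3))
    {β : Type*} [Zero β] {f : EuclideanSpace ℝ (Fin 3) → β} (hf : HasCompactSupport f) :
    HasCompactSupport (fun w => f (NormedSpace.exp (s • B) (w - c))) := by
  have h1 : HasCompactSupport (fun w => f (NormedSpace.exp (s • B) w)) := hasCompactSupport_comp_expSkew hB s hf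
  have e : (fun w => f (NormedSpace.exp (s • B) (w - c))) = (fun w => f (NormedSpace.exp (s • B) w)) ∘ Homeomorph.addRight (-c) := by
    funext w; simp [sub_eq_add_neg]
  rw [e]
  exact h1.comp_homeomorph _

/-- The differential of the transported field `Ξ_t = R_t Ξ(X_t ·)` is the conjugate `R_t ∘ DΞ(X_t w) ∘ R_{−t}`. [folklore] -/
theorem hasFDerivAt_screwRotate (B : EuclideanSpace ℝ (Fin 3) →L[ℝ] EuclideanSpace ℝ (Fin 3)) (t : ℝ) (c : EuclideanSpace ℝ (Fin 3))
    {Ξ : EuclideanSpace ℝ (Fin 3) → EuclideanSpace ℝ (Fin 3)} (hΞ : Differentiable ℝ Ξ) (w : EuclideanSpace ℝ (Fin 3)) :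
    HasFDerivAt (fun w => NormedSpace.exp (t • B) (Ξ (NormedSpace.exp ((-t) • B) (w - c))))
      ((NormedSpace.exp (t • B)).comp ((fderiv ℝ Ξ (NormedSpace.exp ((-t) • B) (w - c))).comp (NormedSpace.exp ((-t) • B)))) w := by
  have h1 : HasFDerivAt (fun w => NormedSpace.exp ((-t) • B) (w - c)) (NormedSpace.exp ((-t) • B)) w := by
    have h := (NormedSpace.exp ((-t) • B)).hasFDerivAt.comp w ((hasFDerivAt_id w).sub_const c)
    rw [ContinuousLinearMap.comp_id] at h
    exact h
  exact (NormedSpace.exp (t • B)).hasFDerivAt.comp w (((hΞ _).hasFDerivAt).comp w h1)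

/-- **Pairings with screw transports are constant when the Killing shear is weakly orthogonal.**  `U ∈ L¹_loc(ℝ³; ℝ³)`, `Ξ` a test field,
`B` skew with `Bb = 0`, and for every `t` the transported field `Ξ_t = R_t Ξ(X_t ·)`, `X_t w = R_{−t}(w − tb)`, satisfies
`∫ ⟪U, DΞ_t(B· + b) − BΞ_t⟫ = 0` (written with `DΞ_t(w)(Bw + b) = R_t DΞ(X_t w)(B X_t w + b)`).  Then `∫ ⟪U, Ξ_s⟫ = ∫ ⟪U, Ξ⟫` for every `s`.
[folklore] -/
theorem integral_inner_screw_eq_of_shear (hB : ∀ x : EuclideanSpace ℝ (Fin 3), ⟪B x, x⟫ = 0) (hb : B b = 0)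
    {U Ξ : EuclideanSpace ℝ (Fin 3) → EuclideanSpace ℝ (Fin 3)}
    (hU : LocallyIntegrable U volume) (hΞ : IsTestFunctionOn (⊤ : Opens (EuclideanSpace ℝ (Fin 3))) Ξ)
    (horth : ∀ t : ℝ, ∫ w, ⟪U w, NormedSpace.exp (t • B) (fderiv ℝ Ξ (NormedSpace.exp ((-t) • B) (w - t • b))
        (B (NormedSpace.exp ((-t) • B) (w - t • b)) + b)) -
      B (NormedSpace.exp (t • B) (Ξ (NormedSpace.exp ((-t) • B) (w - t • b))))⟫ = 0) (s : ℝ) :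
    ∫ w, ⟪U w, NormedSpace.exp (s • B) (Ξ (NormedSpace.exp ((-s) • B) (w - s • b)))⟫ = ∫ w, ⟪U w, Ξ w⟫ := by
  have hΞc : Continuous Ξ := hΞ.contDiff.continuous
  have hΞd : Differentiable ℝ Ξ := hΞ.contDiff.differentiable (by simp)
  have hDΞc : Continuous (fderiv ℝ Ξ) := hΞ.contDiff.continuous_fderiv (by simp)
  have hDΞs : HasCompactSupport (fderiv ℝ Ξ) := hΞ.hasCompactSupport.fderiv (𝕜 := ℝ)
  obtain ⟨M₀, hM₀⟩ := hΞc.bounded_above_of_compact_support hΞ.hasCompactSupport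
  obtain ⟨M₁, hM₁⟩ := hDΞc.bounded_above_of_compact_support hDΞs
  have hM₀0 : 0 ≤ M₀ := (norm_nonneg _).trans (hM₀ 0)
  have hM₁0 : 0 ≤ M₁ := (norm_nonneg _).trans (hM₁ 0)
  obtain ⟨R₀, hR₀0, hR₀⟩ := (hΞ.hasCompactSupport.isCompact.isBounded).subset_closedBall_lt 0 (0 : EuclideanSpace ℝ (Fin 3))
  have hnorm : ∀ (t : ℝ) (v : EuclideanSpace ℝ (Fin 3)), ‖NormedSpace.exp (t • B) v‖ = ‖v‖ := fun t v =>
    TypeIRate.norm_exp_smul_skew hB t v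
  have hRc : ∀ t : ℝ, Continuous fun w : EuclideanSpace ℝ (Fin 3) => NormedSpace.exp (t • B) w := fun t =>
    (NormedSpace.exp (t • B)).continuous
  -- the inverse screw motion `X t w = R_{−t}(w − t b)` and the support radius
  set X : ℝ → EuclideanSpace ℝ (Fin 3) → EuclideanSpace ℝ (Fin 3) := fun t w => NormedSpace.exp ((-t) • B) (w - t • b) with hX
  have hXc : ∀ t : ℝ, Continuous (X t) := fun t => (hRc (-t)).comp (continuous_id.sub continuous_const)
  have hXn : ∀ (t : ℝ) (w : EuclideanSpace ℝ (Fin 3)), ‖w‖ ≤ ‖X t w‖ + |t| * ‖b‖ := by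
    intro t w
    have h1 : ‖X t w‖ = ‖w - t • b‖ := by rw [hX]; exact hnorm _ _
    rw [h1]
    calc ‖w‖ ≤ ‖w - t • b‖ + ‖t • b‖ := norm_le_norm_sub_add w (t • b)
      _ = ‖w - t • b‖ + |t| * ‖b‖ := by rw [norm_smul, Real.norm_eq_abs]
  have hoff : ∀ (t : ℝ) (w : EuclideanSpace ℝ (Fin 3)), R₀ < ‖X t w‖ → Ξ (X t w) = 0 ∧ fderiv ℝ Ξ (X t w) = 0 := by
    intro t w hw
    have hzt : X t w ∉ tsupport Ξ := fun hmem => (not_le.2 hw) (mem_closedBall_zero_iff.1 (hR₀ hmem))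
    refine ⟨image_eq_zero_of_notMem_tsupport hzt, ?_⟩
    by_contra hne
    exact hzt (support_fderiv_subset ℝ (mem_support.2 hne))
  set I : ℝ → ℝ := fun t => ∫ w, ⟪U w, NormedSpace.exp (t • B) (Ξ (X t w))⟫ with hI
  set F' : ℝ → EuclideanSpace ℝ (Fin 3) → ℝ := fun t w =>
    ⟪U w, B (NormedSpace.exp (t • B) (Ξ (X t w))) + NormedSpace.exp (t • B) (fderiv ℝ Ξ (X t w) (-(B (X t w) + b)))⟫ with hF'
  have hderiv : ∀ t₀ : ℝ, HasDerivAt I 0 t₀ := by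
    intro t₀
    set K : Set (EuclideanSpace ℝ (Fin 3)) := closedBall 0 (R₀ + (|t₀| + 1) * ‖b‖) with hK
    have hKc : IsCompact K := isCompact_closedBall _ _
    set bound : EuclideanSpace ℝ (Fin 3) → ℝ := K.indicator fun w => ‖B‖ * M₀ * ‖U w‖ + M₁ * (‖B‖ * R₀ + ‖b‖) * ‖U w‖ with hbound
    have hbound_int : Integrable bound volume := by
      rw [hbound, integrable_indicator_iff hKc.measurableSet]
      exact ((hU.integrableOn_isCompact hKc).norm.const_mul (‖B‖ * M₀)).add
        ((hU.integrableOn_isCompact hKc).norm.const_mul (M₁ * (‖B‖ * R₀ + ‖b‖)))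
    have hbound_nn : ∀ w, 0 ≤ bound w := by
      intro w
      rw [hbound]
      refine Set.indicator_nonneg (fun w _ => ?_) w
      positivity
    have hcontF : ∀ t : ℝ, Continuous fun w => NormedSpace.exp (t • B) (Ξ (X t w)) := fun t =>
      (hRc t).comp (hΞc.comp (hXc t))
    have hF_meas : ∀ t : ℝ, AEStronglyMeasurable (fun w => ⟪U w, NormedSpace.exp (t • B) (Ξ (X t w))⟫) volume := fun t =>
      hU.aestronglyMeasurable.inner (hcontF t).aestronglyMeasurable
    have hF_int : Integrable (fun w => ⟪U w, NormedSpace.exp (t₀ • B) (Ξ (X t₀ w))⟫) volume := by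
      refine integrable_inner_of_locallyIntegrable_of_hasCompactSupport hU (hcontF t₀) ?_
      exact (hasCompactSupport_comp_screwInv hB (-t₀) (t₀ • b) hΞ.hasCompactSupport).comp_left (map_zero _)
    have hF'_meas : AEStronglyMeasurable (F' t₀) volume := by
      refine hU.aestronglyMeasurable.inner (Continuous.aestronglyMeasurable ?_)
      exact (B.continuous.comp (hcontF t₀)).add
        ((hRc t₀).comp (((hDΞc.comp (hXc t₀)).clm_apply (((B.continuous.comp (hXc t₀)).add continuous_const).neg))))
    have h_bound : ∀ᵐ w ∂(volume : Measure (EuclideanSpace ℝ (Fin 3))), ∀ t ∈ ball t₀ 1, ‖F' t w‖ ≤ bound w := by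
      refine ae_of_all _ fun w t ht => ?_
      have ht' : |t| < |t₀| + 1 := by
        have h1 := mem_ball_iff_norm.1 ht
        rw [Real.norm_eq_abs] at h1
        have h2 := abs_sub_abs_le_abs_sub t t₀
        linarith
      by_cases hw : ‖X t w‖ ≤ R₀
      · -- then `w ∈ K` and the integrand is bounded by the two terms
        have hwK : w ∈ K := by
          rw [hK, mem_closedBall_zero_iff]
          have := hXn t w
          nlinarith [norm_nonneg b, abs_nonneg t]
        rw [hbound, indicator_of_mem hwK, hF']
        calc ‖⟪U w, B (NormedSpace.exp (t • B) (Ξ (X t w))) + NormedSpace.exp (t • B) (fderiv ℝ Ξ (X t w) (-(B (X t w) + b)))⟫‖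
            ≤ ‖U w‖ * ‖B (NormedSpace.exp (t • B) (Ξ (X t w))) + NormedSpace.exp (t • B) (fderiv ℝ Ξ (X t w) (-(B (X t w) + b)))‖ :=
              norm_inner_le_norm _ _
          _ ≤ ‖U w‖ * (‖B‖ * M₀ + M₁ * (‖B‖ * R₀ + ‖b‖)) := by
              gcongr
              refine (norm_add_le _ _).trans (add_le_add ?_ ?_)
              · calc ‖B (NormedSpace.exp (t • B) (Ξ (X t w)))‖ ≤ ‖B‖ * ‖NormedSpace.exp (t • B) (Ξ (X t w))‖ := B.le_opNorm _
                  _ ≤ ‖B‖ * M₀ := by rw [hnorm]; exact mul_le_mul_of_nonneg_left (hM₀ _) (norm_nonneg _)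
              · rw [hnorm]
                calc ‖fderiv ℝ Ξ (X t w) (-(B (X t w) + b))‖ ≤ ‖fderiv ℝ Ξ (X t w)‖ * ‖-(B (X t w) + b)‖ :=
                      ContinuousLinearMap.le_opNorm _ _
                  _ ≤ M₁ * (‖B‖ * R₀ + ‖b‖) := by
                      refine mul_le_mul (hM₁ _) ?_ (norm_nonneg _) hM₁0
                      rw [norm_neg]
                      calc ‖B (X t w) + b‖ ≤ ‖B (X t w)‖ + ‖b‖ := norm_add_le _ _
                        _ ≤ ‖B‖ * ‖X t w‖ + ‖b‖ := by gcongr; exact B.le_opNorm _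
                        _ ≤ ‖B‖ * R₀ + ‖b‖ := by gcongr
          _ = ‖B‖ * M₀ * ‖U w‖ + M₁ * (‖B‖ * R₀ + ‖b‖) * ‖U w‖ := by ring
      · obtain ⟨h0, hD0⟩ := hoff t w (not_le.1 hw)
        have : F' t w = 0 := by
          simp only [hF', h0, hD0, map_zero, zero_apply, add_zero, inner_zero_right]
        rw [this, norm_zero]
        exact hbound_nn w
    have h_diff : ∀ᵐ w ∂(volume : Measure (EuclideanSpace ℝ (Fin 3))), ∀ t ∈ ball t₀ 1,
        HasDerivAt (fun t : ℝ => ⟪U w, NormedSpace.exp (t • B) (Ξ (X t w))⟫) (F' t w) t := by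
      refine ae_of_all _ fun w t _ => ?_
      have h1 : HasDerivAt (fun s : ℝ => Ξ (X s w)) (fderiv ℝ Ξ (X t w) (-(B (X t w) + b))) t :=
        (hΞd _).hasFDerivAt.comp_hasDerivAt t (hasDerivAt_screwInv_apply B hb w t)
      have h2 := (hasDerivAt_exp_smul_const' (𝕂 := ℝ) B t).clm_apply h1
      have h3 : HasDerivAt (fun s : ℝ => NormedSpace.exp (s • B) (Ξ (X s w)))
          (B (NormedSpace.exp (t • B) (Ξ (X t w))) + NormedSpace.exp (t • B) (fderiv ℝ Ξ (X t w) (-(B (X t w) + b)))) t :=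
        h2.congr_deriv rfl
      have h := (hasDerivAt_const t (U w)).inner ℝ h3
      simpa [hF'] using h
    have hmain := hasDerivAt_integral_of_dominated_loc_of_deriv_le (ball_mem_nhds t₀ one_pos)
      (Eventually.of_forall hF_meas) hF_int hF'_meas h_bound hbound_int h_diff
    have hval : ∫ w, F' t₀ w = 0 := by
      have e1 : (fun w => F' t₀ w) = fun w =>
          -⟪U w, NormedSpace.exp (t₀ • B) (fderiv ℝ Ξ (X t₀ w) (B (X t₀ w) + b)) - B (NormedSpace.exp (t₀ • B) (Ξ (X t₀ w)))⟫ := by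
        funext w
        simp only [hF', map_neg]
        rw [← inner_neg_right]
        congr 1
        abel
      rw [e1, integral_neg]
      have h0 := horth t₀
      simp only [hX] at h0 ⊢
      rw [h0, neg_zero]
    rw [hval] at hmain
    exact hmain.2
  have hdiffI : Differentiable ℝ I := fun t => (hderiv t).differentiableAt
  have hI0 : ∀ t, deriv I t = 0 := fun t => (hderiv t).deriv
  have hconst := is_const_of_deriv_eq_zero hdiffI hI0 s 0
  simp only [hI, hX, neg_zero, zero_smul, sub_zero, expSkew_zero_apply] at hconst
  exact hconst

end Killing

end Summit.NavierStokesRegularity.NavierStokesRegularity.Theorems.PowerGaugeEulerLiouville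

end
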